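import Summits.CriticalPhenomena.CardyFormulaZ2.Theses.CardySelfDualSegment

/-!
# Assembly of route `CardySelfDualSegment` (sub-problem `CardyFormulaZ2`)

Item `stmt-CriticalPhenomena-14650`: the assembly statement
`SegmentOpen → UniformMarginality → SegmentClosed → UniformBoxCrossing → SmirnovBasePoint →
QuarterTurnPinning → CrudeToCanonical → CardyFormulaZ2` of the route
`route-CriticalPhenomena-CardySelfDualSegment`.  It is literally the type of the route's
deciding theorem `CardySelfDualSegment.closes` (the continuity method on `[0,1]`: the set
`G = {t | ∃ α, 0 < α.im ∧ CardyMod t α}` is open by `SegmentOpen` fed with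
`UniformMarginality`, closed by `SegmentClosed` fed with `UniformBoxCrossing` and
`UniformMarginality`, contains `0` by `SmirnovBasePoint` since `Im ζ = sin (π/3) > 0`, hence is
all of the preconnected `unitInterval`; `QuarterTurnPinning` turns `1 ∈ G` into crude Cardy on
`ℤ²` and `CrudeToCanonical` into `CardyFormulaZ2`).

Two proofs are recorded: `cardySelfDualSegment_assembly_proof` is the one-line reference to
`closes`; `cardySelfDualSegment_assembly_sweep` re-runs the sweep from the seven hypotheses
without referring to `closes`, so that the item stays closed by a self-contained term.
-/

namespace Summit.CriticalPhenomena.CardyFormulaZ2.Theorems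

open Summit.CriticalPhenomena.CardyFormulaZ2.Theses

/-- **Assembly of the `CardySelfDualSegment` route, self-contained sweep** (item
`stmt-CriticalPhenomena-14650`): the seven route hypotheses imply `CardyFormulaZ2`.
Continuity method on `[0,1]`: `G = {t | ∃ α, 0 < α.im ∧ CardyMod t α}` is clopen
(`SegmentOpen`/`SegmentClosed` fed by `UniformMarginality` and `UniformBoxCrossing`) and
contains `0` (`SmirnovBasePoint`, `0 < Im triZeta`), so `G = univ` in the preconnected
`unitInterval`; at `t = 1`, `QuarterTurnPinning` gives crude Cardy on `ℤ²` in every conformal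
rectangle and `CrudeToCanonical` gives `CardyFormulaZ2`. -/
theorem cardySelfDualSegment_assembly_sweep : CardySelfDualSegment.Assembly := by
  unfold CardySelfDualSegment.Assembly
  intro hO hM hC hX hB hQ hD R
  refine hD (hQ ?_) R
  have hGo := hO hM
  have hGc := hC hX hM
  have hclopen : IsClopen _ := ⟨hGc, hGo⟩
  have hz : 0 < Literature.Probability.LatticeModels.triZeta.im := by
    unfold Literature.Probability.LatticeModels.triZeta
    rw [Complex.exp_im]
    have hre : ((Real.pi : ℂ) * Complex.I / 3).re = 0 := by simp
    have him : ((Real.pi : ℂ) * Complex.I / 3).im = Real.pi / 3 := by simp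
    rw [hre, him, Real.exp_zero, one_mul]
    exact Real.sin_pos_of_pos_of_lt_pi (by positivity) (by linarith [Real.pi_pos])
  haveI : PreconnectedSpace unitInterval := Subtype.preconnectedSpace isPreconnected_Icc
  have huniv := hclopen.eq_univ ⟨0, Literature.Probability.LatticeModels.triZeta, hz, hB⟩
  exact (Set.eq_univ_iff_forall.mp huniv) 1

/-- **Assembly of the `CardySelfDualSegment` route** (item `stmt-CriticalPhenomena-14650`):
the seven route hypotheses `SegmentOpen`, `UniformMarginality`, `SegmentClosed`,
`UniformBoxCrossing`, `SmirnovBasePoint`, `QuarterTurnPinning`, `CrudeToCanonical` imply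
`CardyFormulaZ2` — verbatim the type of the route's deciding theorem
`CardySelfDualSegment.closes`, which proves it. -/
theorem cardySelfDualSegment_assembly_proof : CardySelfDualSegment.Assembly := by
  unfold CardySelfDualSegment.Assembly
  exact CardySelfDualSegment.closes

end Summit.CriticalPhenomena.CardyFormulaZ2.Theorems
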